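import Literature.NumberTheory.EllipticCurves.ShintaniLiftQExpansion
import Literature.NumberTheory.EllipticCurves.ShintaniGenusSymmetry
import HarnessLib

/-!
# Symmetry of the Shintani lift coefficients in `(D, n)`

[[cite: Shintani1975, §2, Thm. 2]] (the genus characters) and [[cite: Kohnen1985, §1, proof of
Cor. 1: the symmetry of `r(f; D, D')` in `D, D'`]] — the orbits with `n(v) = D D'` contribute to
`c_D(D')` and to `c_{D'}(D)` with the same canonical data `sgn(λ) P(ω)` and with genus weights
`ω_D(v) = ω_{D'}(v)` (`ShintaniGenusSymmetry.genusWt_eq_of_nQ_eq_mul`), whence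
`√D' · c_D(D') = √D · c_{D'}(D)` for odd square-free `D ≡ D' (mod 4)`.  We PROVE
`cD_eq_genusWt`, `orbExp_symm_aux` and **`liftCoeff_symm`**.

No named facts, no new definitions.
-/

noncomputable section

open scoped MatrixGroups ModularForm Modular Topology
open UpperHalfPlane hiding I
open Complex Filter MeasureTheory Set CongruenceSubgroup ModularGroup Real MulAction
open Literature.NumberTheory.EllipticCurves.ModularForms

namespace Literature.NumberTheory.EllipticCurves.Shintani

variable (D : ℕ) [NeZero D]

/-! ### Symmetry of the coefficients in `(D, n)` (genus theory) -/

omit [NeZero D] in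
/-- `c_D(k) = ω_D(v)` on `L`. [folklore] -/
theorem cD_eq_genusWt {k : Fin 3 → ℤ} (h : (128 : ℤ) ∣ k 1) : cD D k = (genusWt D (vOf k) : ℂ) := by
  rw [cD, if_pos h]; rfl

/-- The key case: if `c_D(k_ω) ≠ 0` and `n_ω^{(D)} = D'` then `n(v) = D D'`, `n_ω^{(D')} = D` and
`c_D(k_ω) = c_{D'}(k_ω)` (`D ≡ D' (mod 4)` odd square-free). [cite: Shintani1975, §2, Thm. 2] -/
theorem orbExp_symm_aux {D D' : ℕ} (hD : Squarefree D) (hD' : Squarefree D') (hDodd : Odd D) (hD'odd : Odd D')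
    (hmod : D % 4 = D' % 4) {ω : orbitRel.Quotient (Gamma0Plus 64) (Fin 3 → ℤ)}
    (hpos : 0 < intDisc ω.out) (hc : cD D ω.out ≠ 0) (he : orbExp D ω = D') :
    orbExp D' ω = D ∧ cD D ω.out = cD D' ω.out := by
  obtain ⟨h128, hdvd⟩ := dvd_of_cD_ne_zero hD hc
  have hΔ := intDisc_eq_of_dvd h128 (k := ω.out)
  have hnpos : 0 < nQ (vOf ω.out) := by rw [hΔ] at hpos; linarith
  have hD0 : (D : ℤ) ≠ 0 := by exact_mod_cast hD.ne_zero
  have hD'0 : (D' : ℤ) ≠ 0 := by exact_mod_cast hD'.ne_zero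
  have hq : 0 ≤ nQ (vOf ω.out) / D := Int.ediv_nonneg hnpos.le (by positivity)
  -- `n(v) = D D'`
  have hn : nQ (vOf ω.out) = D * D' := by
    rw [orbExp] at he
    have h1 : nQ (vOf ω.out) / D = D' := by
      have := congrArg (fun n : ℕ ↦ (n : ℤ)) he
      simp only [Int.toNat_of_nonneg hq] at this
      exact this
    rw [Int.eq_mul_of_ediv_eq_right hdvd h1]
  refine ⟨?_, ?_⟩
  · rw [orbExp, hn, mul_comm, Int.mul_ediv_cancel_left _ hD'0, Int.toNat_natCast]
  · rw [cD_eq_genusWt D h128, cD_eq_genusWt D' h128, genusWt_eq_of_nQ_eq_mul hD hD' hDodd hD'odd hmod hn]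

/-- **Symmetry of the lift coefficients**: `√D' · c_D(D') = √D · c_{D'}(D)` for odd square-free
`D ≡ D' (mod 4)` — termwise on orbits: the orbits with `n(v) = D D'` contribute to both, with the
same canonical data `sgn(λ) P(ω)` and genus weights `ω_D(v) = ω_{D'}(v)`. [cite: Shintani1975, §2, Thm. 2] -/
theorem liftCoeff_symm (f : CuspForm (Gamma0 64) 2) {D D' : ℕ} [NeZero D] [NeZero D']
    (hD : Squarefree D) (hD' : Squarefree D') (hDodd : Odd D) (hD'odd : Odd D') (hmod : D % 4 = D' % 4) :
    (Real.sqrt D' : ℂ) * liftCoeff D f D' = (Real.sqrt D : ℂ) * liftCoeff D' f D := by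
  classical
  rw [liftCoeff, liftCoeff, tsum_subtype, tsum_subtype, ← tsum_mul_left, ← tsum_mul_left]
  refine tsum_congr fun ω ↦ ?_
  simp only [Set.indicator_apply, Set.mem_preimage, Set.mem_singleton_iff]
  -- both coefficients vanish unless `Δ > 0`
  by_cases hpos : 0 < intDisc ω.out
  swap
  · simp [orbCoef, dif_neg hpos]
  -- the canonical data
  have main : ∀ {E E' : ℕ} [NeZero E] [NeZero E'], Squarefree E → Squarefree E' → Odd E → Odd E' → E % 4 = E' % 4 →
      cD E ω.out ≠ 0 →
      (Real.sqrt E' : ℂ) * (if orbExp E ω = E' then orbCoef E f ω else 0) =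
        (Real.sqrt E : ℂ) * (if orbExp E' ω = E then orbCoef E' f ω else 0) := by
    intro E E' _ _ hE hE' hEodd hE'odd hmod' hc
    by_cases he : orbExp E ω = E'
    · obtain ⟨he', hcc⟩ := orbExp_symm_aux hE hE' hEodd hE'odd hmod' hpos hc he
      rw [if_pos he, if_pos he', orbCoef, orbCoef, dif_pos hpos, dif_pos hpos, hcc]
      push_cast; ring
    · rw [if_neg he, mul_zero]
      by_cases he' : orbExp E' ω = E
      · rw [if_pos he']
        by_cases hc' : cD E' ω.out = 0
        · simp [orbCoef, dif_pos hpos, hc']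
        · obtain ⟨he'', -⟩ := orbExp_symm_aux hE' hE hE'odd hEodd hmod'.symm hpos hc' he'
          exact absurd he'' he
      · rw [if_neg he', mul_zero]
  by_cases hc : cD D ω.out = 0
  · by_cases hc' : cD D' ω.out = 0
    · simp [orbCoef, dif_pos hpos, hc, hc']
    · exact (main hD' hD hD'odd hDodd hmod.symm hc').symm
  · exact main hD hD' hDodd hD'odd hmod hc

end Literature.NumberTheory.EllipticCurves.Shintani
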